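import Summits.HodgeConjecture.HodgeConjecture.Theorems.HeckePrymWeilWeilTwelvefoldsSqrtMinus7OfWeilTransport
import HarnessLib

/-!
# Crux `WeilTwelvefoldsSqrtMinus7`: the two minimal pairs (family fact, transport) at `(7, 6)` — modulo the WEAKEST family facts

Route `HeckePrymWeil` (sub-problem `HodgeConjecture`); lead seat c6 of crux `WeilTwelvefoldsSqrtMinus7`
(stmt-HodgeConjecture-1261), line `isotypic-unimodular-saturation`, reshape r5 ("global action").

The landed compositions of the line consume LESS than the family fact the earlier skeletons registered
(M3 = `deligne1982_weilFamily_levelStructure`, Deligne's level-`n` abelian scheme):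

* r4/r5's composition `hodgeWeil_of_weilTransport_of_globalAction` reads only
  M′ = `deligne1982_weilFamily_globalAction` (the abelian scheme with a GLOBAL `√-p`, balanced fibres, a
  flat Weil section, a tensor-split fibre) together with the WEIL transport `WT(7, 6)` (variational Hodge
  for global classes fibrewise in the Weil plane of a chart);
* r3's composition `hodgeWeil_of_transport_of_sections` reads only the still weaker
  M″ = `deligne1982_weilFamily_hodgeWeilSection` (flat, fibrewise-Hodge Weil section and tensor-split
  fibre, NO global `√-p`) together with the transport `T(7, 6)` of ALL rational `(6,6)` global classes
  (= `WeilVariationalHodge`, stmt-HodgeConjecture-14497, at `M = 6`).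

In the tree M3 ⟹ `…_kAction` ⟹ M′ ⟹ M″ and `T(7,6) ⟹ WT(7,6)`; the pair (M″, WT) is NOT available (the
Weil-plane clause at every fibre, which WT needs, is what the global `√-p` of M′ supplies).  This file
records the crux instances MODULO THE WEAKEST AVAILABLE FAMILY FACT of each pair:

* `weilTwelvefoldsSqrtMinus7_of_weilTransport_of_globalAction` — crux ⟸ M′ + `WT(7, 6)` (r5 composition);
* `weilTwelvefoldsSqrtMinus7_iff_weilTransport_of_globalAction` — MODULO M′, crux ⟺ `WT(7, 6)`
  (tightness `weilTransport_six_of_weilTwelvefoldsSqrtMinus7` is family-free);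
* `weilTwelvefoldsSqrtMinus7_of_transport_of_hodgeWeilSection` — crux ⟸ M″ + `T(7, 6)`;
* `weilTwelvefoldsSqrtMinus7_of_weilVariationalHodge_of_hodgeWeilSection` — crux ⟸ M″ +
  `WeilVariationalHodge` (the EXISTING ledger item stmt-HodgeConjecture-14497);
* `weilTwelvefoldsSqrtMinus7_of_weilVariationalHodge_of_globalAction` — crux ⟸ M′ + `WeilVariationalHodge`;
* `hodgeWeilLadder_iff_weilTransport_of_globalAction` — MODULO M′ (not M3), the route TARGET
  `HodgeWeilLadder` (stmt-HodgeConjecture-1259) ⟺ the Weil transport `WT(p, k)` at every `p ≡ 3 (4)` prime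
  `≥ 7`, `k ≥ 1` (forward direction family-free, via the PROVED `WeilDescending`).

So item stmt-HodgeConjecture-1261 is, given Deligne's family in the form M′, EXACTLY `WT(7, 6)` — an
HC-implied, crux-implied, André-motivated instance of Grothendieck's variational Hodge conjecture for flat
Weil classes of `√-7`-twelvefold families — and, given it in the form M″, a consequence of the existing crux
stmt-HodgeConjecture-14497.  CONDITIONAL on the hypotheses spelled out; no `sorry`, no new definition.
-/

noncomputable section

-- every declaration of this problem lives in `Summit.HodgeConjecture.HodgeConjecture.…` (summit = sub-problem)
set_option linter.dupNamespace false

open CategoryTheory AlgebraicGeometry Limits MonoidalCategory CartesianMonoidalCategory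

namespace Summit.HodgeConjecture.HodgeConjecture.Theorems.HeckePrymWeilLine

open Literature.AlgebraicGeometry Literature.AlgebraicGeometry.Motives Literature.AlgebraicGeometry.HodgeTheory
open Literature.AlgebraicTopology.SingularHomology
open Summit.HodgeConjecture.HodgeConjecture.Theses.HeckePrymWeil

/-! ### The pair (M′, WT(7,6)) -/

/-- **The crux `WeilTwelvefoldsSqrtMinus7` (stmt-HodgeConjecture-1261) from Deligne's abelian scheme with a
global `√-p` (`deligne1982_weilFamily_globalAction`, M′) and the WEIL transport at `(7, 6)`** — the r5
composition of line `isotypic-unimodular-saturation`, VERBATIM the instance `(p, k) = (7, 6)` of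
`hodgeWeil_of_weilTransport_of_globalAction` (CONDITIONAL result).
[cite: Deligne1982HodgeCycles, proof of Thm. 4.8 (pp. 47–52), clauses (a)–(c), Lemma 4.5, Remark 4.10]
[cite: Grothendieck1966, footnote 13] -/
theorem weilTwelvefoldsSqrtMinus7_of_weilTransport_of_globalAction
    (hGA : deligne1982_weilFamily_globalAction)
    (hT : ∀ ⦃𝒳 S : SchemeOver ℂ⦄ (f : 𝒳 ⟶ S), IsSmoothProjectiveFamily f (2 * 6) →
      IrreducibleSpace S.left → AlgebraicGeometry.Smooth S.hom →
      ∀ (W : complexBetti 𝒳 (2 * 6)),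
        (∀ s : ComplexPoints S, IsRationalClass (complexBetti.map (fiberι f s) (2 * 6) W) ∧
          IsOfHodgeType (2 * 6) (fiberOver f s) (2 * 6) 6 6 (complexBetti.map (fiberι f s) (2 * 6) W)) →
        (∀ s : ComplexPoints S, ∃ (A' : AbelianVariety ℂ) (φ' : A' ⟶ A') (e' : A'.X ≅ fiberOver f s),
          A'.dim = 2 * 6 ∧ φ' ≫ φ' = -(((7 : ℕ) : ℤ) • 𝟙 A') ∧
          complexBetti.map e'.hom (2 * 6) (complexBetti.map (fiberι f s) (2 * 6) W) ∈
            weilClassesOf A' φ' 6 7) →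
        (∃ s₀ : ComplexPoints S,
          complexBetti.map (fiberι f s₀) (2 * 6) W ∈ algebraicClasses (fiberOver f s₀) 6) →
        ∀ s : ComplexPoints S,
          complexBetti.map (fiberι f s) (2 * 6) W ∈ algebraicClasses (fiberOver f s) 6) :
    WeilTwelvefoldsSqrtMinus7 := by
  intro A φ hA hφ c hrat hH hW
  exact hodgeWeil_of_weilTransport_of_globalAction hGA (p := 7) (by norm_num) (by norm_num) le_rfl
    (k := 6) (by norm_num) hT A φ hA (by exact_mod_cast hφ) c hrat hH (by exact_mod_cast hW)

/-- **MODULO M′, the crux `WeilTwelvefoldsSqrtMinus7` is EQUIVALENT to the Weil transport at `(7, 6)`** —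
the same certificate as `weilTwelvefoldsSqrtMinus7_iff_weilTransport_of_levelStructure` under the WEAKER
family fact actually read by the composition (tightness is family-free).
[cite: Deligne1982HodgeCycles, proof of Thm. 4.8] [cite: Grothendieck1966, footnote 13] -/
theorem weilTwelvefoldsSqrtMinus7_iff_weilTransport_of_globalAction :
    deligne1982_weilFamily_globalAction →
    (WeilTwelvefoldsSqrtMinus7 ↔
    ∀ ⦃𝒳 S : SchemeOver ℂ⦄ (f : 𝒳 ⟶ S), IsSmoothProjectiveFamily f (2 * 6) →
      IrreducibleSpace S.left → AlgebraicGeometry.Smooth S.hom →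
      ∀ (W : complexBetti 𝒳 (2 * 6)),
        (∀ s : ComplexPoints S, IsRationalClass (complexBetti.map (fiberι f s) (2 * 6) W) ∧
          IsOfHodgeType (2 * 6) (fiberOver f s) (2 * 6) 6 6 (complexBetti.map (fiberι f s) (2 * 6) W)) →
        (∀ s : ComplexPoints S, ∃ (A' : AbelianVariety ℂ) (φ' : A' ⟶ A') (e' : A'.X ≅ fiberOver f s),
          A'.dim = 2 * 6 ∧ φ' ≫ φ' = -(((7 : ℕ) : ℤ) • 𝟙 A') ∧
          complexBetti.map e'.hom (2 * 6) (complexBetti.map (fiberι f s) (2 * 6) W) ∈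
            weilClassesOf A' φ' 6 7) →
        (∃ s₀ : ComplexPoints S,
          complexBetti.map (fiberι f s₀) (2 * 6) W ∈ algebraicClasses (fiberOver f s₀) 6) →
        ∀ s : ComplexPoints S,
          complexBetti.map (fiberι f s) (2 * 6) W ∈ algebraicClasses (fiberOver f s) 6) :=
  fun hGA ↦ ⟨weilTransport_six_of_weilTwelvefoldsSqrtMinus7,
    weilTwelvefoldsSqrtMinus7_of_weilTransport_of_globalAction hGA⟩

/-- **Crux ⟸ M′ + `WeilVariationalHodge`** (stmt-HodgeConjecture-14497): forget the Weil clause of the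
transport (`weilTransport_six_of_weilVariationalHodge`). [cite: Grothendieck1966, footnote 13] -/
theorem weilTwelvefoldsSqrtMinus7_of_weilVariationalHodge_of_globalAction
    (hGA : deligne1982_weilFamily_globalAction) (hV : WeilVariationalHodge) : WeilTwelvefoldsSqrtMinus7 :=
  weilTwelvefoldsSqrtMinus7_of_weilTransport_of_globalAction hGA (weilTransport_six_of_weilVariationalHodge hV)

/-! ### The pair (M″, T(7,6)) -/

/-- **The crux `WeilTwelvefoldsSqrtMinus7` from the WEAKEST family package M″
(`deligne1982_weilFamily_hodgeWeilSection`: flat fibrewise-Hodge Weil section, tensor-split fibre, no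
global `√-p`) and the transport `T(7, 6)` of ALL rational `(6,6)` global classes along smooth projective
families of `√-7`-abelian twelvefolds over smooth irreducible bases** — the instance `(p, k) = (7, 6)` of
r3's composition `hodgeWeil_of_transport_of_sections`, its W-engine discharged by the tree's
`deligne1968_invariantClass_fromTotalSpace_holds` (CONDITIONAL result).
[cite: Deligne1982HodgeCycles, proof of Thm. 4.8 (pp. 47–52) with Prop. 4.4, Lemma 4.5, Remark 4.10]
[cite: Grothendieck1966, footnote 13] -/
theorem weilTwelvefoldsSqrtMinus7_of_transport_of_hodgeWeilSection
    (hWF : deligne1982_weilFamily_hodgeWeilSection)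
    (hT : ∀ ⦃𝒳 S : SchemeOver ℂ⦄ (f : 𝒳 ⟶ S), IsSmoothProjectiveFamily f (2 * 6) →
      IrreducibleSpace S.left → AlgebraicGeometry.Smooth S.hom →
      ∀ (W : complexBetti 𝒳 (2 * 6)),
        (∀ s : ComplexPoints S, IsRationalClass (complexBetti.map (fiberι f s) (2 * 6) W) ∧
          IsOfHodgeType (2 * 6) (fiberOver f s) (2 * 6) 6 6 (complexBetti.map (fiberι f s) (2 * 6) W)) →
        (∀ s : ComplexPoints S, ∃ (A' : AbelianVariety ℂ) (φ' : A' ⟶ A'),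
          A'.dim = 2 * 6 ∧ φ' ≫ φ' = -(((7 : ℕ) : ℤ) • 𝟙 A') ∧ Nonempty (A'.X ≅ fiberOver f s)) →
        (∃ s₀ : ComplexPoints S,
          complexBetti.map (fiberι f s₀) (2 * 6) W ∈ algebraicClasses (fiberOver f s₀) 6) →
        ∀ s : ComplexPoints S,
          complexBetti.map (fiberι f s) (2 * 6) W ∈ algebraicClasses (fiberOver f s) 6) :
    WeilTwelvefoldsSqrtMinus7 := by
  intro A φ hA hφ c hrat hH hW
  exact hodgeWeil_of_transport_of_sections
    (stub_globalClassOfSection_of_leray deligne1968_invariantClass_fromTotalSpace_holds) hWF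
    (p := 7) (by norm_num) (by norm_num) le_rfl (k := 6) (by norm_num) hT
    A φ hA (by exact_mod_cast hφ) c hrat hH (by exact_mod_cast hW)

/-- **Crux ⟸ M″ + `WeilVariationalHodge`** (stmt-HodgeConjecture-14497, the EXISTING ledger item on which,
together with the Weil-family named fact, item stmt-HodgeConjecture-1261 is parked) — the instance
`(7, 6)` of `hodgeWeil_of_weilVariationalHodge_of_hodgeWeilSection`. [cite: Grothendieck1966, footnote 13]
[cite: Deligne1982HodgeCycles, proof of Thm. 4.8] -/
theorem weilTwelvefoldsSqrtMinus7_of_weilVariationalHodge_of_hodgeWeilSection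
    (hWF : deligne1982_weilFamily_hodgeWeilSection) (hV : WeilVariationalHodge) :
    WeilTwelvefoldsSqrtMinus7 := by
  intro A φ hA hφ c hrat hH hW
  exact hodgeWeil_of_weilVariationalHodge_of_hodgeWeilSection hWF hV 7 (by norm_num) (by norm_num) le_rfl
    6 (by norm_num) A φ hA (by exact_mod_cast hφ) c hrat hH (by exact_mod_cast hW)

/-! ### The route target modulo M′: `HodgeWeilLadder` ⟺ Weil transport at every `(p, k)` -/

/-- **MODULO M′ (the global-action package, not the level-`n` package M3), the route TARGET
`HodgeWeilLadder` (stmt-HodgeConjecture-1259) is EQUIVALENT to the Weil transport `WT(p, k)` for every prime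
`p ≡ 3 (4)`, `p ≥ 7`, and every `k ≥ 1`.**  Forward (family-free): the ladder and the PROVED support
`WeilDescending` give `HWA(p, k)` for every `k ≥ 1` (`heckePrymWeil_ladder_descent`, step `(p-1)/2`), whence
`WT(p, k)` by tightness (`weilTransport_of_hodgeWeil`).  Backward: `hodgeWeil_of_weilTransport_of_globalAction`
at the rungs `k = (p-1)/2 · (g-1) ≥ 3`. [cite: Deligne1982HodgeCycles, proof of Thm. 4.8]
[cite: Grothendieck1966, footnote 13] [cite: vanGeemen1994HodgeAV, 4.9] -/
theorem hodgeWeilLadder_iff_weilTransport_of_globalAction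
    (hGA : deligne1982_weilFamily_globalAction) :
    HodgeWeilLadder ↔
    (∀ p : ℕ, p.Prime → p % 4 = 3 → 7 ≤ p → ∀ k : ℕ, 1 ≤ k →
      ∀ ⦃𝒳 S : SchemeOver ℂ⦄ (f : 𝒳 ⟶ S), IsSmoothProjectiveFamily f (2 * k) →
      IrreducibleSpace S.left → AlgebraicGeometry.Smooth S.hom →
      ∀ (W : complexBetti 𝒳 (2 * k)),
        (∀ s : ComplexPoints S, IsRationalClass (complexBetti.map (fiberι f s) (2 * k) W) ∧
          IsOfHodgeType (2 * k) (fiberOver f s) (2 * k) k k (complexBetti.map (fiberι f s) (2 * k) W)) →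
        (∀ s : ComplexPoints S, ∃ (A' : AbelianVariety ℂ) (φ' : A' ⟶ A') (e' : A'.X ≅ fiberOver f s),
          A'.dim = 2 * k ∧ φ' ≫ φ' = -((p : ℤ) • 𝟙 A') ∧
          complexBetti.map e'.hom (2 * k) (complexBetti.map (fiberι f s) (2 * k) W) ∈
            weilClassesOf A' φ' k p) →
        (∃ s₀ : ComplexPoints S,
          complexBetti.map (fiberι f s₀) (2 * k) W ∈ algebraicClasses (fiberOver f s₀) k) →
        ∀ s : ComplexPoints S,
          complexBetti.map (fiberι f s) (2 * k) W ∈ algebraicClasses (fiberOver f s) k) := by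
  constructor
  · intro hL p hp hp4 hp7 k hk
    refine weilTransport_of_hodgeWeil (p := p) (k := k) ?_
    -- `HWA(p, k)` for every `k ≥ 1` from the ladder and the proved `WeilDescending`
    exact Theorems.heckePrymWeil_ladder_descent
      (fun n ↦ ∀ (A : AbelianVariety ℂ) (φ : A ⟶ A), A.dim = 2 * n → φ ≫ φ = -((p : ℤ) • 𝟙 A) →
        ∀ c : complexBetti A.X (2 * n), IsRationalClass c → IsOfHodgeType (2 * n) A.X (2 * n) n n c →
          c ∈ Module.End.eigenspace (complexBetti.map (𝟙 A + φ).hom.hom.hom (2 * n)).hom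
                ((1 + Complex.I * (Real.sqrt (p : ℝ) : ℂ)) ^ (2 * n)) ⊔
              Module.End.eigenspace (complexBetti.map (𝟙 A + φ).hom.hom.hom (2 * n)).hom
                ((1 - Complex.I * (Real.sqrt (p : ℝ) : ℂ)) ^ (2 * n)) →
          c ∈ algebraicClasses A.X n)
      ((p - 1) / 2) (by omega) (hL p hp hp4 hp7) (Theorems.weilDescending_proof p hp hp4 hp7) k hk
  · intro hT p hp hp4 hp7 g hg n hn A φ hA hφ c hrat hH hW
    have hn1 : 1 ≤ n := by have := owf_three_le_k hp7 hg hn; omega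
    exact hodgeWeil_of_weilTransport_of_globalAction hGA hp hp4 hp7 hn1 (hT p hp hp4 hp7 n hn1)
      A φ hA hφ c hrat hH hW

end Summit.HodgeConjecture.HodgeConjecture.Theorems.HeckePrymWeilLine

end
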